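import Summits.BirchSwinnertonDyer.BirchSwinnertonDyer.Theorems.BiquadraticEisensteinDescentDeuringRowEightThousand
import Literature.NumberTheory.EllipticCurves.SqrtTwoTwistGrossencharakter
import HarnessLib

set_option linter.dupNamespace false -- `Summit.BirchSwinnertonDyer.BirchSwinnertonDyer.Theorems.…` (summit = sub)
set_option autoImplicit false

/-!
# BED route, «Deuring-ψ lane»: the row `j = 8000` of `Deuring_exists_heckeCharacter_of_maximalCM`, UNCONDITIONAL

Route `BiquadraticEisensteinDescent` of `Summits/BirchSwinnertonDyer` (crux `EisensteinHeartFlatCMInertBadKPrime`, stmt-BirchSwinnertonDyer-21341;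
cell `bsd-wall`, seat w4 g17). THEOREMS ONLY. Sequel of `…DeuringRowEightThousand` (row modulo CORE(`cm8`)): the second base
`cm8 = B₁ = [0,4,0,2,0]` (`a_p = χ₄(p)·S(p)`) gets its CORE from the `χ₄ ∘ N`-twisted Rajwade character of `ℚ(√−2)`
(`SqrtNegTwo.exists_isGrossencharakter_datum_chiFour`, seat w1 g14) and `SqrtTwoTwist.lFunction_B_one_eq_chiFour_mul_primarySum`
(Brewer's theorem, proved in the tree), through `core_of_datum`.

* `core_cm8` — CORE for `cm8` over every CM field of `j = 8000`;
* ★★★ `deuring_of_j_eq_8000` — all five Deuring clauses for every globally minimal `W/ℚ` with `W.j = 8000`, every `K` with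
  `IsCMFieldOfJ K W.j`, every `c ≠ 1`. Seventh of the nine rows of the maximal-CM table.

BSD is not proved by any of this. References: [SilvermanATAEC1994] II Thm. 9.2, Thm. 10.5; [Rajwade1968] Thm. 1.
-/

noncomputable section

open scoped Classical NumberField NumberTheorySymbols ComplexConjugate
open NumberField IsDedekindDomain WeierstrassCurve Rat.HeightOneSpectrum
  Literature.NumberTheory.GaloisRepresentations
  Literature.NumberTheory.EllipticCurves
  Literature.NumberTheory.QuadraticFields
open Literature.NumberTheory.LFunctions (idealPow)

namespace Summit.BirchSwinnertonDyer.BirchSwinnertonDyer.Theorems.BiquadraticEisensteinDescentDeuringOfCore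

variable {K : Type} [Field K] [NumberField K]

/-- ★ **CORE for `cm8 = B₁ = [0, 4, 0, 2, 0]` (`a_p = χ₄(p)·S(p)`) over every CM field of `j = 8000`**: `ψ = heckeOfGross` of the
`χ₄ ∘ N`-twist of Rajwade's character (`SqrtNegTwo.exists_isGrossencharakter_datum_chiFour`), witness `n = 5`, bad prime `2` only.
[cite: Rajwade1968, Thm. 1] [cite: SilvermanATAEC1994, Ch. II Thm. 10.5 (b)] -/
theorem core_cm8 (hK : IsCMFieldOfJ K 8000) :
    ∃ ψ : HeckeCharacter K, ψ.HasInfinityType (fun _ ↦ 1) (fun _ ↦ 0) ∧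
      ∀ s : ℂ, 3 / 2 < s.re → heckeLFunction ψ s = cm8.LSeries s := by
  obtain ⟨θ, hF, hdK⟩ := fieldData_of_isCMFieldOfJ_8000 hK
  have h2 := hK.1
  haveI := hF.isTotallyComplex
  obtain ⟨c, hc⟩ := GrossCurve.exists_algEquiv_ne_one (K := K) h2
  obtain ⟨w₀⟩ : Nonempty (InfinitePlace K) := inferInstance
  have hf : ∀ p : ℕ, p.Prime → p ≠ 2 →
      (((fun p : ℕ ↦ cm8.LFunction p) p : ℤ) : ℤ√(-2)) = (ZMod.χ₄ (p : ZMod 4) : ℤ√(-2)) * SqrtNegTwoPrimary.primarySum p :=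
    fun p hp hp2 ↦ SqrtTwoTwist.lFunction_B_one_eq_chiFour_mul_primarySum hp hp2
  obtain ⟨𝔣, ψ₀, h𝔣, h𝔣v, hψ₀, -, hwit, hfrob⟩ :=
    SqrtNegTwo.exists_isGrossencharakter_datum_chiFour hF hc w₀ (fun p : ℕ ↦ cm8.LFunction p) hf
  obtain ⟨hN, h20⟩ := conductor_B_unit (n := 1) (Or.inl rfl)
  rw [← cm8_eq] at hN h20
  have hdisc : ∀ p : ℕ, p.Prime → ((p : ℤ) ∣ NumberField.discr K ↔ p = 2) := by
    intro p hp
    rw [hdK, dvd_neg, show (8 : ℤ) = ((2 ^ 3 : ℕ) : ℤ) by norm_num, Int.natCast_dvd_natCast]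
    exact ⟨fun h ↦ (Nat.prime_dvd_prime_iff_eq hp Nat.prime_two).mp (hp.dvd_of_dvd_pow h), fun h ↦ by subst h; norm_num⟩
  refine core_of_datum cm8 h2 Nat.prime_two hdisc hc h𝔣 hψ₀ (fun v ↦ by rw [h𝔣v v, Nat.cast_ofNat]) (n := 5)
    (Int.isCoprime_iff_gcd_eq_one.mpr rfl) ?_ (fun p hp hp2 v hv ↦ (hfrob p hp hp2 v hv).2) h20 hN
  have h5 := hwit 5 (Or.inl rfl)
  rw [show ((5 : ℕ) : 𝓞 K) = ((5 : ℤ) : 𝓞 K) by push_cast; rfl] at h5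
  rw [h5]; push_cast; norm_num

/-- **The row `j = 8000` of the CORE**: every elliptic `W/ℚ` with `W.j = 8000` and every CM field `K` of `8000` carry a Hecke character of
type `(1,0)` with `L(s, ψ) = L(W, s)` on `re s > 3/2`. [cite: SilvermanATAEC1994, Ch. II Thm. 10.5 (b)] -/
theorem core_of_j_eq_8000 (hK : IsCMFieldOfJ K 8000) (W : WeierstrassCurve ℚ) [W.IsElliptic] (hjW : W.j = 8000) :
    ∃ ψ : HeckeCharacter K, ψ.HasInfinityType (fun _ ↦ 1) (fun _ ↦ 0) ∧
      ∀ s : ℂ, 3 / 2 < s.re → heckeLFunction ψ s = W.LSeries s :=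
  core_of_j_eq_8000_of_core_cm8 hK (core_cm8 hK) W hjW

/-- ★★★ **Deuring's theorem, row `j = 8000` (`K = ℚ(√−2)`), UNCONDITIONAL**: all five clauses of
`Deuring_exists_heckeCharacter_of_maximalCM` for every globally minimal `W/ℚ` with `W.j = 8000`, every `K` with `IsCMFieldOfJ K W.j`
and every `c ≠ 1`. [cite: SilvermanATAEC1994, Ch. II Thm. 9.2, Thm. 10.5] [cite: Rajwade1968, Thm. 1] -/
theorem deuring_of_j_eq_8000 (W : WeierstrassCurve ℚ) [W.IsElliptic] [W.IsGloballyMinimal] (hjW : W.j = 8000)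
    (K : Type) [Field K] [NumberField K] (hK : IsCMFieldOfJ K W.j) (c : K ≃ₐ[ℚ] K) (hc : c ≠ 1) :
    ∃ ψ : HeckeCharacter K,
      ψ.HasInfinityType (fun _ ↦ 1) (fun _ ↦ 0) ∧
      IsHeckeConjEquivariant c ψ ∧
      (∀ w : HeightOneSpectrum (𝓞 K), ψ.IsUnramifiedAt w ↔ (W.baseChange K).HasGoodReductionAt w) ∧
      (∀ (p : ℕ) [Fact p.Prime], W.HasGoodReductionAtPrime p →
        ∀ w : HeightOneSpectrum (𝓞 K), (p : 𝓞 K) ∈ w.asIdeal →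
          ψ.IsUnramifiedAt w ∧
          (c • w ≠ w →
            ψ.valueAtUniformizer w + ψ.valueAtUniformizer (c • w) = (W.frobeniusTrace p : ℂ) ∧
            ψ.valueAtUniformizer w * ψ.valueAtUniformizer (c • w) = (p : ℂ)) ∧
          (c • w = w → W.frobeniusTrace p = 0 ∧ ψ.valueAtUniformizer w = -(p : ℂ))) ∧
      ∀ s : ℂ, 3 / 2 < s.re → heckeLFunction ψ s = W.LSeries s :=
  deuring_of_j_eq_8000_of_core_cm8 W hjW K hK (core_cm8 (by rw [← hjW]; exact hK)) c hc

end Summit.BirchSwinnertonDyer.BirchSwinnertonDyer.Theorems.BiquadraticEisensteinDescentDeuringOfCore
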